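import Summits.Langlands.Langlands.Theses.EvenSkinnerWilesMirror
import Literature.NumberTheory.Automorphic.TunnellOctahedralGlobal
import HarnessLib

/-!
# Crux `BianchiMirrorParity` (stmt-Langlands-15309) — the strategist's typed split (glue for `route edit --split`)

Glue for the DECOMPOSITION of the crux
`Summit.Langlands.Langlands.Theses.EvenSkinnerWilesMirror.BianchiMirrorParity` (stmt-Langlands-15309, route
Langlands/EvenSkinnerWilesMirror, rank 2: for `ρ : Γ_ℚ → GL₂(ℚ̄_p)` a.e. unramified with `ρ|_{Γ_K}` irreducible,
`K` imaginary quadratic, `det ρ` a finite-order twist of an ODD power `ε^{k-1}` of the cyclotomic character (`k` even),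
and `ρ|_{Γ_K}` weakly Bianchi-modular — Satake–Frobenius compatible at cofinitely many places with an `L`-algebraic
cuspidal `π` on `GL₂(𝔸_K)` — the representation `ρ` is ODD) into four leaf statements, exactly the route's foreseen
two-layer plan "DescentToQ → CentralCharacterParity → OddFromRegularDescent" with the last step cut once more along the
seam external-theorem / Galois lemma.  Recorded by the crux-strategist seat `cstrat-stmt-Langlands-15309-r1`.

CHILDREN (the four hypotheses of `bianchiMirrorParity_of_subs`, verbatim the `statement`s filed with
`route edit --split BianchiMirrorParity`):
* `MirrorDescent` (X₁, support — KNOWN IN PRINT, formal debt): `π` descends to an `L`-algebraic cuspidal `π₀` on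
  `GL₂(𝔸_ℚ)` of which it is a weak base change lift (`IsWeakBaseChangeLiftAE π₀ π`: `t_{π,w} = t_{π₀,v}^{f(w|v)}` a.e.).
  In print: the Satake data of `π` are `Gal(K/ℚ)`-stable because they are the Frobenius eigenvalues of a representation
  of `Γ_ℚ` (Frobenius elements at `w` and `c(w)` are `Γ_ℚ`-conjugate); cyclic descent of prime degree, Arthur–Clozel
  1989 Ch. 3 Thm. 4.2 (d) (tree: `cuspidal_descent_cyclic`); `L`-algebraicity descends along the archimedean clause of
  strong lifting, Ch. 3 Thm. 5.1 with Ch. 1 §7 (tree: `ArthurClozel1989_strongLifting_archimedean.isLAlgebraic_descent`,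
  with Harish-Chandra uniqueness `AutomorphicRepData.hasArchParameter_unique`, proved).
* `DescentWeightParity` (X₂, crux — THE NORMALISATION RISK ISOLATED): for such a descent `π₀`, some (`L`-algebraic)
  infinity type `T` of `π₀` has `a`-exponents summing, at every embedding, to one ODD integer `m` (namely `±(k-1)`):
  `det ρ|_K ↔ ω_π⁻¹` at the uniformisers of cofinitely many `w` (the arithmetic-Frobenius, `L`-normalised dictionary of
  `Summit.Langlands.SatakeFrobCompatibleAt`, and `ω_π(ϖ_w) = ∏ t_{π,w}`, tree
  `AutomorphicRepData.exists_centralCharacter`), so `ω_π^N = ‖·‖_K^{(k-1)N}` by rigidity of Hecke characters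
  (`HeckeCharacter.ext_of_eventually_valueAtUniformizer_eq`), whence `∑ χ_π(τ) = k - 1` at each `τ : K → ℂ`
  (differential of the central character, `HasArchParameter.apply_scalar`) and `∑ χ_{π₀}(τ|_ℚ) = ∑ χ_π(τ)`
  (Arthur–Clozel Prop. 4.4 (ii), tree `sum_archParameter_eq_of_isWeakBaseChangeLiftAE`).
* `RegularDescentOddGaloisRep` (X₃, crux — DELIGNE, the one printed input the tree lacks): a cuspidal `π₀` on
  `GL₂(𝔸_ℚ)` with a REGULAR `L`-algebraic infinity type carries an ODD `r : Γ_ℚ → GL₂(ℚ̄_p)` Satake–Frobenius compatible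
  with it at cofinitely many `v` (`π₀ = π_g ⊗ |det|^j`, `g` a holomorphic newform of weight `a₁ - a₂ + 1 ≥ 2` — unitary
  principal or complementary series with integral distinct exponents do not exist —, `r = r_{g,ι} ⊗ ε^j`, Deligne 1971;
  `det r(c) = -1`; every twist / dual / conjugate of `r_g` is odd, so the statement is robust to the dictionary's signs).
* `OddnessAlongMirror` (X₄, support — GALOIS LEMMA, provable now): if `r` is odd and Satake–Frobenius compatible with `π₀`,
  `π₀ ↝ π` (weak base change) and `π ↔ ρ|_K`, with `ρ|_K` irreducible, then `ρ` is odd: the Frobenius characteristic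
  polynomials of `r|_K` and `ρ|_K` agree at cofinitely many `w` (tree `FramedGaloisRep.hasFrobCharpolyAt_restrictField_fin_two`,
  Satake uniqueness `hasSatakeParamAt_unique_holds`), so `ρ|_K ≅ (r|_K)^{ss}` (Chebotarev + Brauer–Nesbitt), `r|_K` is
  irreducible, `ρ ≅ r ⊗ χ` with `χ` trivial on `Γ_K` (Clifford / Frobenius reciprocity), and `det ρ(c) = det r(c) χ(c)² = -1`.

THEOREM `bianchiMirrorParity_of_subs` — the assembly, NOT a one-line seam: it threads the witnesses
(`π ↦ π₀ ↦ (T, m) ↦ r`) and PROVES the parity trick in between, `isRegular_of_isLAlgebraic_of_odd_sum`: an `L`-algebraic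
rank-2 infinity type whose two integral `a`-exponents sum to an odd integer is REGULAR (two integers with odd sum differ,
`nodup_of_card_two_of_int_of_odd_sum`) — which is exactly how "`k` even" enters the route ("`a + b = ±(k−1)` odd ⇒ `a ≠ b`
⇒ regular ⇒ Deligne ⇒ odd"; the algebraic-Maass loophole `a = b` is the excluded even sum).  HONESTY: the conjunction
of the children implies the crux (this file) and is not obviously implied by it (X₃ is Deligne's theorem for every
regular `L`-algebraic `π₀`, X₄ for every odd `r`); no child mentions `ρ.IsOdd` except X₄, whose oddness is an INPUT.
No new definitions; sorry-free; the children are stated over existing declarations only (`IsWeakBaseChangeLiftAE`,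
`InfinityType`, `HasInfinityType`, `ArchWeight.a`, `SatakeFrobCompatibleAt`, `FramedGaloisRep.IsOdd/restrictField`).
-/

-- `Summit.<Summit>.<Problem>` is the mandated summit-side namespace (CONVENTIONS §2); for the single-conjunct
-- summit `Langlands` the two coincide, so the duplicate `Langlands.Langlands` is deliberate.
set_option linter.dupNamespace false

namespace Summit.Langlands.Langlands.Theorems

open Filter

/-- Two integers with odd sum are distinct, read on a `2`-element multiset of complex numbers all of whose members are
integers: such a multiset with odd integral sum has no duplicate. [folklore] -/
theorem nodup_of_card_two_of_int_of_odd_sum {s : Multiset ℂ} (hcard : Multiset.card s = 2)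
    (hint : ∀ x ∈ s, ∃ k : ℤ, x = k) {m : ℤ} (hm : Odd m) (hsum : s.sum = (m : ℂ)) : s.Nodup := by
  obtain ⟨x, y, rfl⟩ := Multiset.card_eq_two.mp hcard
  obtain ⟨kx, hkx⟩ := hint x (by simp)
  obtain ⟨ky, hky⟩ := hint y (by simp)
  have hs : x + y = (m : ℂ) := by simpa using hsum
  rw [hkx, hky] at hs
  have hk : kx + ky = m := by exact_mod_cast hs
  refine Multiset.nodup_cons.mpr ⟨?_, Multiset.nodup_singleton _⟩
  intro hmem
  rw [Multiset.mem_singleton, hkx, hky] at hmem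
  have hxy : kx = ky := by exact_mod_cast hmem
  subst hxy
  exact (Int.not_even_iff_odd.mpr hm) ⟨kx, hk.symm⟩

/-- **The parity trick.** An `L`-algebraic rank-`2` infinity type over `ℚ` whose `a`-exponents sum, at every complex
embedding, to an odd integer is regular (Clozel: pairwise distinct `a`'s): the two `a`-exponents are integers
(`IsLAlgebraic`), there are exactly two of them (`IsWellFormed`), and two integers with odd sum differ.  This is the step
"`a + b = ±(k-1)` odd ⇒ `a ≠ b`" of the route's lever; the excluded case `a = b` (even sum) is the algebraic-Maass /
weight-one loophole. [folklore] -/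
theorem isRegular_of_isLAlgebraic_of_odd_sum {T : Literature.NumberTheory.Automorphic.InfinityType ℚ 2}
    (hwf : T.IsWellFormed) (hL : T.IsLAlgebraic) {m : ℤ} (hm : Odd m)
    (hsum : ∀ σ : ℚ →+* ℂ, ((T σ).map Literature.NumberTheory.Automorphic.ArchWeight.a).sum = (m : ℂ)) :
    T.IsRegular := by
  intro σ
  refine nodup_of_card_two_of_int_of_odd_sum ?_ ?_ hm (hsum σ)
  · rw [Multiset.card_map, hwf.1 σ]
  · intro x hx
    obtain ⟨q, hq, rfl⟩ := Multiset.mem_map.mp hx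
    obtain ⟨k, l, hk, -⟩ := hL σ q hq
    exact ⟨k, hk⟩

/-- **Typed split of `BianchiMirrorParity`.**  Hypotheses, in order (the four children filed with
`route edit --split BianchiMirrorParity`, verbatim): (X₁) `MirrorDescent` — descent of `π` to an `L`-algebraic cuspidal
`π₀` on `GL₂(𝔸_ℚ)` weakly base-changing to `π`; (X₂) `DescentWeightParity` — some `L`-algebraic infinity type of such a
`π₀` has `a`-exponents summing to an odd integer at every embedding; (X₃) `RegularDescentOddGaloisRep` — Deligne: a
cuspidal `π₀` on `GL₂(𝔸_ℚ)` with a regular `L`-algebraic infinity type has an odd Satake–Frobenius-compatible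
`r : Γ_ℚ → GL₂(ℚ̄_p)`; (X₄) `OddnessAlongMirror` — oddness passes from `r` to `ρ` along `r ↔ π₀ ↝ π ↔ ρ|_K` when `ρ|_K`
is irreducible.  Conclusion: the route decl `EvenSkinnerWilesMirror.BianchiMirrorParity`.  Proof: fix the data of the
crux and its witness `π`; descend (X₁); read the odd weight parity (X₂) and convert it into regularity by the parity
trick `isRegular_of_isLAlgebraic_of_odd_sum`; attach Deligne's odd `r` (X₃); transport oddness (X₄). [folklore] -/
theorem bianchiMirrorParity_of_subs
    (h1 : ∀ (p : ℕ) [Fact p.Prime] (K : Type) [Field K] [NumberField K], NumberField.IsTotallyComplex K → Module.finrank ℚ K = 2 → ∀ (hcpt : Literature.NumberTheory.Automorphic.isCompact_glFiniteIntegralLevel 2 K) (hℚ : Literature.NumberTheory.Automorphic.isCompact_glFiniteIntegralLevel 2 ℚ) (ι : PadicAlgCl p ≃+* ℂ) (ρ : Literature.NumberTheory.GaloisRepresentations.FramedGaloisRep ℚ (PadicAlgCl p) 2) (π : Literature.NumberTheory.Automorphic.CuspidalAutomorphicRepData 2 K hcpt), π.1.IsLAlgebraic → (∀ᶠ w in cofinite,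 Summit.Langlands.SatakeFrobCompatibleAt ι π.1 (ρ.restrictField K) w) → ∃ π₀ : Literature.NumberTheory.Automorphic.CuspidalAutomorphicRepData 2 ℚ hℚ, π₀.1.IsLAlgebraic ∧ Literature.NumberTheory.Automorphic.IsWeakBaseChangeLiftAE π₀.1 π.1)
    (h2 : ∀ (p : ℕ) [Fact p.Prime] (K : Type) [Field K] [NumberField K], NumberField.IsTotallyComplex K → Module.finrank ℚ K = 2 → ∀ (hcpt : Literature.NumberTheory.Automorphic.isCompact_glFiniteIntegralLevel 2 K) (hℚ : Literature.NumberTheory.Automorphic.isCompact_glFiniteIntegralLevel 2 ℚ) (ι : PadicAlgCl p ≃+* ℂ) (ρ : Literature.NumberTheory.GaloisRepresentations.FramedGaloisRep ℚ (PadicAlgCl p) 2) (π : Literature.NumberTheory.Automorphic.CuspidalAutomorphicRepData 2 K hcpt) (π₀ : Literature.NumberTheory.Automorphic.CuspidalAutomorphicRepData 2 ℚ hℚ), (∀ᶠ v in cofinite, ρ.IsUnramifiedAt v) → (∃ k N : ℕ, 2 ≤ k ∧ Even k ∧ 0 < N ∧ ∀ g : Field.absoluteGaloisGroup ℚ, ((Matrix.GeneralLinearGroup.det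 (ρ g) : (PadicAlgCl p)ˣ) : PadicAlgCl p) ^ N = algebraMap (Padic p) (PadicAlgCl p) (((Literature.NumberTheory.GaloisRepresentations.GaloisRep.cyclotomicCharacter ℚ p g).val : PadicInt p) : Padic p) ^ ((k - 1) * N)) → (∀ᶠ w in cofinite, Summit.Langlands.SatakeFrobCompatibleAt ι π.1 (ρ.restrictField K) w) → Literature.NumberTheory.Automorphic.IsWeakBaseChangeLiftAE π₀.1 π.1 → π₀.1.IsLAlgebraic → ∃ T : Literature.NumberTheory.Automorphic.InfinityType ℚ 2, π₀.1.HasInfinityType T ∧ T.IsLAlgebraic ∧ ∃ m : ℤ, Odd m ∧ ∀ σ : ℚ →+* ℂ, ((T σ).map Literature.NumberTheory.Automorphic.ArchWeight.a).sum = (m : ℂ))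
    (h3 : ∀ (p : ℕ) [Fact p.Prime] (hℚ : Literature.NumberTheory.Automorphic.isCompact_glFiniteIntegralLevel 2 ℚ) (ι : PadicAlgCl p ≃+* ℂ) (π₀ : Literature.NumberTheory.Automorphic.CuspidalAutomorphicRepData 2 ℚ hℚ), (∃ T : Literature.NumberTheory.Automorphic.InfinityType ℚ 2, π₀.1.HasInfinityType T ∧ T.IsLAlgebraic ∧ T.IsRegular) → ∃ r : Literature.NumberTheory.GaloisRepresentations.FramedGaloisRep ℚ (PadicAlgCl p) 2, r.IsOdd ∧ ∀ᶠ v in cofinite, Summit.Langlands.SatakeFrobCompatibleAt ι π₀.1 r v)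
    (h4 : ∀ (p : ℕ) [Fact p.Prime] (K : Type) [Field K] [NumberField K], NumberField.IsTotallyComplex K → Module.finrank ℚ K = 2 → ∀ (hcpt : Literature.NumberTheory.Automorphic.isCompact_glFiniteIntegralLevel 2 K) (hℚ : Literature.NumberTheory.Automorphic.isCompact_glFiniteIntegralLevel 2 ℚ) (ι : PadicAlgCl p ≃+* ℂ) (ρ r : Literature.NumberTheory.GaloisRepresentations.FramedGaloisRep ℚ (PadicAlgCl p) 2) (π : Literature.NumberTheory.Automorphic.CuspidalAutomorphicRepData 2 K hcpt) (π₀ : Literature.NumberTheory.Automorphic.CuspidalAutomorphicRepData 2 ℚ hℚ), (ρ.restrictField K).toGaloisRep.IsIrreducible → r.IsOdd → (∀ᶠ w in cofinite, Summit.Langlands.SatakeFrobCompatibleAt ι π.1 (ρ.restrictField K) w) → Literature.NumberTheory.Automorphic.IsWeakBaseChangeLiftAE π₀.1 π.1 → (∀ᶠ v in cofinite, Summit.Langlands.SatakeFrobCompatibleAt ι π₀.1 r v) → ρ.IsOdd) :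
    Summit.Langlands.Langlands.Theses.EvenSkinnerWilesMirror.BianchiMirrorParity := by
  intro p _ K _ _ hKc hK2 hcpt ι ρ hirr hunr hdet hmod
  obtain ⟨π, hπL, hπsat⟩ := hmod
  -- the automorphy datum of `GL₂(𝔸_ℚ)` (a true Prop, typing `π₀`)
  have hℚ : Literature.NumberTheory.Automorphic.isCompact_glFiniteIntegralLevel 2 ℚ :=
    Literature.NumberTheory.Automorphic.isCompact_glFiniteIntegralLevel_holds 2 ℚ
  -- X₁: descend through the mirror
  obtain ⟨π₀, hπ₀L, hBC⟩ := h1 p K hKc hK2 hcpt hℚ ι ρ π hπL hπsat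
  -- X₂: the weight of the descent has odd parity …
  obtain ⟨T, hT, hTL, m, hm, hsum⟩ := h2 p K hKc hK2 hcpt hℚ ι ρ π π₀ hunr hdet hπsat hBC hπ₀L
  -- … which makes the `L`-algebraic infinity type regular (the parity trick, proved above)
  have hreg : T.IsRegular := isRegular_of_isLAlgebraic_of_odd_sum hT.1 hTL hm hsum
  -- X₃: Deligne's odd Galois representation of the regular `L`-algebraic `π₀`
  obtain ⟨r, hrodd, hrsat⟩ := h3 p hℚ ι π₀ ⟨T, hT, hTL, hreg⟩
  -- X₄: oddness travels back along `r ↔ π₀ ↝ π ↔ ρ|_K`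
  exact h4 p K hKc hK2 hcpt hℚ ι ρ r π π₀ hirr hrodd hπsat hBC hrsat

end Summit.Langlands.Langlands.Theorems
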